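import Mathlib

/-!
# SoloBlind E49 — the fine print of the `(N+1)`-side of the Eisenstein modulus law (identity C431)

Solo programme `solo-Langlands-blind`, own line (O1b), s118.  For primes `q ≠ N` the conjectured
EISENSTEIN MODULUS LAW (law U, C429) for the new quotient of the Hecke ring of `Γ₀(qN)` reads
`m_new(qN) = n⁺_q(N) · gcd((q−1)·[G_N : ⟨Frob_q⟩], N−1)` with the `(N+1)`-side factor
`n⁺_q(N) = (N+1) / gcd(N+1, D(q))`, `D(q) = 2^{2−[4 ∣ q−1]} · 3^{1−[3 ∣ q−1]}`.
The kernel-checked content of this file is the elementary identity behind the observation (C431)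
that for odd `q` this factor is `num((q−1)(N+1)/24) / num((q−1)/12)`, i.e. the order of the rational
cuspidal divisor of Atkin–Lehner signs `(w_q, w_N) = (−1,+1)` at level `qN` divided by Mazur's
Eisenstein number `n_q` ("in the `(−,+)` cell the Eisenstein lengths add"):

* `gcd_mul_twentyfour` : for even `m`, `n`: `gcd(m·n, 24) = gcd(m, 12) · gcd(n, D)` with `D = fineD m`;
* `nplus_mul_mazur`    : `((N+1)/gcd(N+1, D(q))) · ((q−1)/gcd(q−1,12)) = (q−1)(N+1)/gcd((q−1)(N+1), 24)`
  for `q − 1` and `N + 1` even (all odd primes `q`, `N`), where `x / gcd(x,k) = num(x/k)`.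

No Hecke algebras are formalised here; this is the arithmetic skeleton only.
-/

set_option linter.dupNamespace false

namespace Summit.Langlands.Langlands.Theorems.SoloBlindCellGcd

/-- The fine-print denominator `D(q)` of law U's `(N+1)`-side as a function of `m = q − 1`:
`2^{2−[4 ∣ m]} · 3^{1−[3 ∣ m]}`. -/
def fineD (m : ℕ) : ℕ := (if 4 ∣ m then 2 else 4) * (if 3 ∣ m then 1 else 3)

/-- `D(q)` divides `12`. -/
theorem fineD_dvd_twelve (m : ℕ) : fineD m ∣ 12 := by
  unfold fineD
  split_ifs <;> norm_num

/-- `D` depends only on `m mod 24` (indeed only on `m mod 12`). -/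
theorem fineD_mod (m : ℕ) : fineD (m % 24) = fineD m := by
  have h4 : (4 ∣ m % 24) ↔ 4 ∣ m := Nat.dvd_mod_iff (by norm_num)
  have h3 : (3 ∣ m % 24) ↔ 3 ∣ m := Nat.dvd_mod_iff (by norm_num)
  by_cases h4m : 4 ∣ m
  · by_cases h3m : 3 ∣ m
    · simp [fineD, h4m, h3m, h4.2 h4m, h3.2 h3m]
    · simp [fineD, h4m, h3m, h4.2 h4m, mt h3.1 h3m]
  · by_cases h3m : 3 ∣ m
    · simp [fineD, h4m, h3m, mt h4.1 h4m, h3.2 h3m]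
    · simp [fineD, h4m, h3m, mt h4.1 h4m, mt h3.1 h3m]

/-- The finite core: the identity on residues modulo `24`. -/
theorem key_fin : ∀ a b : Fin 24, 2 ∣ (a : ℕ) → 2 ∣ (b : ℕ) →
    Nat.gcd ((a : ℕ) * b % 24) 24 = Nat.gcd ((a : ℕ) % 12) 12 * Nat.gcd ((b : ℕ) % 12) (fineD a) := by
  decide

/-- For even `m` and even `n`: `gcd(m n, 24) = gcd(m, 12) · gcd(n, D(m))`
(false without `2 ∣ n`: `m = 8, n = 3`). -/
theorem gcd_mul_twentyfour (m n : ℕ) (hm : 2 ∣ m) (hn : 2 ∣ n) :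
    Nat.gcd (m * n) 24 = Nat.gcd m 12 * Nat.gcd n (fineD m) := by
  have ha : m % 24 < 24 := Nat.mod_lt _ (by norm_num)
  have hb : n % 24 < 24 := Nat.mod_lt _ (by norm_num)
  have h2 : 2 ∣ m % 24 := (Nat.dvd_mod_iff (by norm_num : 2 ∣ 24)).2 hm
  have h2' : 2 ∣ n % 24 := (Nat.dvd_mod_iff (by norm_num : 2 ∣ 24)).2 hn
  have k := key_fin ⟨m % 24, ha⟩ ⟨n % 24, hb⟩ h2 h2'
  simp only at k
  rw [← Nat.mul_mod, Nat.mod_mod_of_dvd _ (by norm_num : 12 ∣ 24),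
    Nat.mod_mod_of_dvd _ (by norm_num : 12 ∣ 24), fineD_mod] at k
  have e1 : Nat.gcd (m * n) 24 = Nat.gcd (m * n % 24) 24 :=
    ((Nat.mod_modEq (m * n) 24).gcd_eq).symm
  have e2 : Nat.gcd m 12 = Nat.gcd (m % 12) 12 := ((Nat.mod_modEq m 12).gcd_eq).symm
  have e3 : Nat.gcd n (fineD m) = Nat.gcd (n % 12) (fineD m) := by
    have h12 : n % 12 ≡ n [MOD fineD m] :=
      Nat.ModEq.of_dvd (fineD_dvd_twelve m) (Nat.mod_modEq n 12)
    exact (h12.gcd_eq).symm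
  rw [e1, e2, e3]
  exact k

/-- Identity C431 in integer form: `num((N+1)/D(q)) · num((q−1)/12) = num((q−1)(N+1)/24)` for
`q − 1` even, writing `num(x/k) = x / gcd(x,k)`. -/
theorem nplus_mul_mazur (q N : ℕ) (hq : 2 ∣ q - 1) (hN : 2 ∣ N + 1) :
    ((N + 1) / Nat.gcd (N + 1) (fineD (q - 1))) * ((q - 1) / Nat.gcd (q - 1) 12)
      = ((q - 1) * (N + 1)) / Nat.gcd ((q - 1) * (N + 1)) 24 := by
  rw [gcd_mul_twentyfour (q - 1) (N + 1) hq hN, mul_comm ((N + 1) / _) _,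
    Nat.div_mul_div_comm (Nat.gcd_dvd_left _ _) (Nat.gcd_dvd_left _ _)]

/-- Sanity instances: `q = 7, N = 19` (`5 · 1 = 5`), `q = 17, N = 7` (`4 · 4 = 16`),
`q = 41, N = 17` (`3 · 10 = 30`). -/
example : ((19 + 1) / Nat.gcd (19 + 1) (fineD (7 - 1))) * ((7 - 1) / Nat.gcd (7 - 1) 12) = 5 := by decide
example : ((7 + 1) / Nat.gcd (7 + 1) (fineD (17 - 1))) * ((17 - 1) / Nat.gcd (17 - 1) 12) = 16 := by decide
example : ((17 + 1) / Nat.gcd (17 + 1) (fineD (41 - 1))) * ((41 - 1) / Nat.gcd (41 - 1) 12) = 30 := by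
  decide

end Summit.Langlands.Langlands.Theorems.SoloBlindCellGcd
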